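import Literature.Analysis.FluidPDE.ClassicalSolution
import HarnessLib

/-!
# Route `EfficiencyFloor`, crux `MaximiserSetRigidity` (stmt-NavierStokesRegularity-25512), part (b), rotating case:
# a rotating self-similar orbit `u(t,x) = λ(t)R(t)m(λ(t)R(t)⁻¹x)` with `λ(t) → ∞` never extends smoothly past `T`

Helper file (`--supports stmt-NavierStokesRegularity-25512`), route-independent (imports only
`Literature.Analysis.FluidPDE.ClassicalSolution`). Second brick of the orbit argument for the driftless rotating
collapse Liouville theorem (L⁺_rot) (first brick: `…RotatingDrift`): the classical solution built from a rotating
backward self-similar profile `m ≢ 0` is MAXIMAL at its collapse time `T`, because along the curve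
`x(t) = λ(t)⁻¹R(t)y⋆` (`m(y⋆) ≠ 0`), which converges to the origin, `|u(t,x(t))| = λ(t)|m(y⋆)| → ∞`, while any classical
extension past `T` is jointly continuous at `(T, 0)`.

* `not_hasSmoothExtensionPast_of_tendsto_norm_atTop` — abstract form: if along some curve `x(t) → x_T` (`t → T⁻`)
  the velocity norm `|u(t,x(t))|` tends to `∞`, then `u` has no smooth extension past `T` (`0 < T`);
* `not_hasSmoothExtensionPast_of_selfSimilarOrbit` — the self-similar / rotating self-similar form: `u t x =
  λ t • R t (m (λ t • (R t).symm x))` on `[0,T)` with linear isometries `R t`, `λ → ∞` at `T⁻`, `m y⋆ ≠ 0`.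

Pure topology (compactness is not even needed: continuity at one point). HONEST FRAMING: a brick; (L⁺_rot), stmt-25512,
`ProductionEfficiencyDecay` and Navier–Stokes regularity stay OPEN; no summit statement is proved. [folklore]
-/

noncomputable section

-- the problem directory repeats the summit name (`NavierStokesRegularity/NavierStokesRegularity`)
set_option linter.dupNamespace false

namespace Summit.NavierStokesRegularity.NavierStokesRegularity.Theorems

namespace MaximiserSetRigidity

namespace RotatingOrbit

open Set Filter Topology Function
open Literature.Analysis Literature.Analysis.FluidPDE

variable {E : Type*} [NormedAddCommGroup E] [InnerProductSpace ℝ E] [FiniteDimensional ℝ E]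

/-- **Blow-up along a convergent curve forbids a smooth extension.** Let `0 < T` and let `x : ℝ → E` be a curve with
`x(t) → x_T` as `t → T⁻` such that `‖u t (x t)‖ → ∞` as `t → T⁻`. Then `u` (whatever it is on `[0,T)`) has no
classical extension past `T`: an extension `u'` on `[0,T')`, `T' > T`, is jointly continuous at `(T, x_T)` and agrees
with `u` at the points `(t, x t)`, `0 ≤ t < T`. [folklore] -/
theorem not_hasSmoothExtensionPast_of_tendsto_norm_atTop {ν T : ℝ} (hT : 0 < T) {f u : ℝ → E → E}
    (x : ℝ → E) (xT : E) (hx : Tendsto x (𝓝[<] T) (𝓝 xT))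
    (hblow : Tendsto (fun t => ‖u t (x t)‖) (𝓝[<] T) atTop) :
    ¬ HasSmoothExtensionPast ν f u T := by
  rintro ⟨T', hT', u', p', hsol, hagree⟩
  -- joint continuity of the extension at `(T, x_T)` within `[0,T') × E`
  have hcont : ContinuousWithinAt (uncurry u') (Ico 0 T' ×ˢ univ) (T, xT) :=
    (hsol.smooth_velocity.continuousOn) (T, xT) (mk_mem_prod ⟨hT.le, hT'⟩ (mem_univ _))
  -- the curve `t ↦ (t, x t)` tends to `(T, x_T)` within that set along `t → T⁻`
  have hcurve : Tendsto (fun t => ((t, x t) : ℝ × E)) (𝓝[<] T) (𝓝[Ico 0 T' ×ˢ univ] (T, xT)) := by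
    refine tendsto_nhdsWithin_iff.2 ⟨?_, ?_⟩
    · have hid : Tendsto (fun t : ℝ => t) (𝓝[<] T) (𝓝 T) := tendsto_nhdsWithin_of_tendsto_nhds tendsto_id
      exact hid.prodMk_nhds hx
    · have h0 : ∀ᶠ t in 𝓝[<] T, 0 ≤ t :=
        eventually_nhdsWithin_of_eventually_nhds (eventually_ge_nhds hT)
      have h1 : ∀ᶠ t in 𝓝[<] T, t < T' :=
        eventually_nhdsWithin_of_eventually_nhds (eventually_lt_nhds hT')
      filter_upwards [h0, h1] with t ht0 ht1
      exact mk_mem_prod ⟨ht0, ht1⟩ (mem_univ _)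
  have hlim : Tendsto (fun t => ‖u' t (x t)‖) (𝓝[<] T) (𝓝 ‖u' T xT‖) :=
    ((hcont.tendsto.comp hcurve).norm)
  -- agreement with `u` for `0 ≤ t < T`
  have hagree' : ∀ᶠ t in 𝓝[<] T, ‖u' t (x t)‖ = ‖u t (x t)‖ := by
    have h0 : ∀ᶠ t in 𝓝[<] T, 0 ≤ t :=
      eventually_nhdsWithin_of_eventually_nhds (eventually_ge_nhds hT)
    have h1 : ∀ᶠ t in 𝓝[<] T, t < T := eventually_mem_nhdsWithin
    filter_upwards [h0, h1] with t ht0 ht1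
    rw [hagree t ⟨ht0, ht1⟩]
  have hblow' : Tendsto (fun t => ‖u' t (x t)‖) (𝓝[<] T) atTop := hblow.congr' (hagree'.mono fun t ht => ht.symm)
  exact hlim.not_tendsto (disjoint_nhds_atTop _) hblow'

/-- **A (rotating) self-similar orbit with a nonzero profile is maximal at its collapse time.** Let `0 < T`,
`R t` linear isometries of `E`, `λ : ℝ → ℝ` with `λ(t) → +∞` as `t → T⁻`, `m : E → E` with `m y⋆ ≠ 0`, and suppose
`u t x = λ t • R t (m (λ t • (R t).symm x))` for `0 ≤ t < T`. Then `u` has no smooth extension past `T`: along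
`x(t) = (λ t)⁻¹ • R t y⋆ → 0` one has `u t (x t) = λ t • R t (m y⋆)`, of norm `λ t · ‖m y⋆‖ → ∞`. This is the
maximality clause `IsMaximalSmoothSolution` needs for the orbit of a rotating backward self-similar profile. [folklore] -/
theorem not_hasSmoothExtensionPast_of_selfSimilarOrbit {ν T : ℝ} (hT : 0 < T) {f u : ℝ → E → E}
    (lam : ℝ → ℝ) (R : ℝ → (E ≃ₗᵢ[ℝ] E)) (m : E → E) (ystar : E) (hm : m ystar ≠ 0)
    (hlam : Tendsto lam (𝓝[<] T) atTop)
    (hu : ∀ t ∈ Ico 0 T, ∀ x : E, u t x = lam t • R t (m (lam t • (R t).symm x))) :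
    ¬ HasSmoothExtensionPast ν f u T := by
  -- the curve and its limit
  set x : ℝ → E := fun t => (lam t)⁻¹ • R t ystar with hx_def
  have hlam0 : ∀ᶠ t in 𝓝[<] T, 0 < lam t := hlam.eventually_gt_atTop 0
  have hxlim : Tendsto x (𝓝[<] T) (𝓝 0) := by
    rw [tendsto_zero_iff_norm_tendsto_zero]
    have e : ∀ t, ‖x t‖ = |(lam t)⁻¹| * ‖ystar‖ := fun t => by
      rw [hx_def]
      simp only [norm_smul, Real.norm_eq_abs, LinearIsometryEquiv.norm_map]
    simp_rw [e]
    have h1 : Tendsto (fun t => (lam t)⁻¹) (𝓝[<] T) (𝓝 0) := hlam.inv_tendsto_atTop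
    have h2 : Tendsto (fun t => |(lam t)⁻¹|) (𝓝[<] T) (𝓝 0) := by
      simpa using h1.abs
    simpa using h2.mul_const ‖ystar‖
  refine not_hasSmoothExtensionPast_of_tendsto_norm_atTop hT x 0 hxlim ?_
  -- the norm along the curve
  have h0 : ∀ᶠ t in 𝓝[<] T, 0 ≤ t := eventually_nhdsWithin_of_eventually_nhds (eventually_ge_nhds hT)
  have h1 : ∀ᶠ t in 𝓝[<] T, t < T := eventually_mem_nhdsWithin
  have heq : ∀ᶠ t in 𝓝[<] T, ‖u t (x t)‖ = lam t * ‖m ystar‖ := by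
    filter_upwards [h0, h1, hlam0] with t ht0 ht1 hl
    have hy : lam t • (R t).symm (x t) = ystar := by
      rw [hx_def]
      simp only [map_smul, LinearIsometryEquiv.symm_apply_apply, smul_smul, mul_inv_cancel₀ hl.ne', one_smul]
    rw [hu t ⟨ht0, ht1⟩, hy, norm_smul, LinearIsometryEquiv.norm_map, Real.norm_eq_abs, abs_of_pos hl]
  refine Tendsto.congr' (heq.mono fun t ht => ht.symm) ?_
  exact hlam.atTop_mul_const (norm_pos_iff.2 hm)

end RotatingOrbit

end MaximiserSetRigidity

end Summit.NavierStokesRegularity.NavierStokesRegularity.Theorems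

end
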